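import Summits.NavierStokesRegularity.NavierStokesRegularity.Theorems.PerpetualPumpAveragedTypeIBlowupIncubationMajorants

/-!
# Crux `PerpetualPump.AveragedTypeIBlowup` (stmt-NavierStokesRegularity-1835), line `Sketch`:
# stub `incubation` — the pre-ignition bootstrap and the truncated companion `incubationTrunc`

Third part of the proof of the registered stub `stub_incubation` (phase I of the window one-step
theorem for the seeded Toda front pair `b' = -b - w² + wl² - ε̄ b w + e₀`,
`w' = w γ + ε̄ b² + e₁`, `γ ∈ [b - 2, b]`, memory errors `|eᵢ| ≤ η mᵢ` with Duhamel majorants).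

* `incubation_boot` — on a pre-ignition horizon `[0, T]` (`w² ≤ θ₀² b`, `20 ≤ B e^{-T}`, `T ≤ 3`,
  `η e^{2T} ≤ 10⁻³`) the weak bounds `B e^{-u} - 3/2 ≤ b ≤ B e^{-u} + Φ₁ + 1/2`,
  `m₁ ≤ μ₁ + ε̄ + 3|w| + 3 ε̄ (B+3)² u` hold throughout (real induction: they hold at `0`, are
  closed, and `incubation_apriori` + `incubation_majorants` return them strictly).
* `incubation_core` — hence all strong pre-ignition bounds hold on `[0, T]`.
* `incubation_growth_upper`, `incubation_growth_lower` — the amplification budget: two-sided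
  bounds `(19/100) ε̄ B e^{∫₀^σ b - 2.03σ} ≤ w(σ) ≤ e^{∫₀^σ b + 3ησ} (W₀ + 2 ε̄ B)` from the rate
  bounds and `linearComparison_lower/upper` (the lower one needs `σ ≥ 1/(2B)` to collect the
  seed).
* `stub_incubationTrunc` — the registered truncated companion of `stub_incubation`: the
  pre-ignition bounds on an arbitrary horizon `[0, T]` on which the data is given and no ignition
  has happened (used by the continuation argument of the line).

## References

T. Tao, *Finite time blowup for an averaged three-dimensional Navier–Stokes equation*, J. Amer.
Math. Soc. 29 (2016), §5–6; folklore ODE bookkeeping.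
-/

noncomputable section

-- the summit namespace `…NavierStokesRegularity.NavierStokesRegularity…` is the tree convention
set_option linter.dupNamespace false

open MeasureTheory Set Filter Topology

namespace Summit.NavierStokesRegularity.NavierStokesRegularity.Theorems.PerpetualPumpAveragedTypeIBlowup

/-- **The bootstrap.** On a pre-ignition horizon `[0, T]` (`w² ≤ θ₀² b`, `20 ≤ B e^{-T}`, `T ≤ 3`,
`η e^{2T} ≤ 10⁻³`) the weak bounds `B e^{-u} - 3/2 ≤ b ≤ B e^{-u} + Φ₁ + 1/2` and
`m₁ ≤ μ₁ + ε̄ + 3|w| + 3 ε̄ (B+3)² u` hold throughout: they hold at `0`, are closed conditions,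
and on any initial segment where they hold `incubation_apriori` + `incubation_majorants` give them
back with strict inequality at the right end (real induction `incubation_induction`). [folklore] -/
theorem incubation_boot {b w γ wl m0 m1 e0 e1 : ℝ → ℝ} {B W₀ εb θ₀ θ η μ₀ μ₁ Φ₁ T : ℝ}
    (hεb : 0 < εb) (hθ₀ : 0 < θ₀) (hθ₀' : θ₀ ≤ 1) (hθ : 1 / 2 ≤ θ) (hη : 0 ≤ η)
    (hη' : η ≤ 1 / 100) (hημ₀ : η * μ₀ ≤ 1 / 10) (hημ₁ : η * μ₁ ≤ εb)
    (hηT : η * Real.exp (2 * T) ≤ 1 / 1000) (hΦ₁' : Φ₁ ≤ 2) (hT0 : 0 ≤ T) (hT3 : T ≤ 3)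
    (hW₀ : 0 ≤ W₀) (hBT : 20 ≤ B * Real.exp (-T))
    (hb : ContinuousOn b (Icc 0 T)) (hw : ContinuousOn w (Icc 0 T))
    (hγ : ContinuousOn γ (Icc 0 T)) (hwl : ContinuousOn wl (Icc 0 T))
    (hm0 : ContinuousOn m0 (Icc 0 T)) (hm1 : ContinuousOn m1 (Icc 0 T))
    (he0 : ContinuousOn e0 (Icc 0 T))
    (hdb : ∀ s ∈ Ioo 0 T,
      HasDerivAt b (-(b s) - (w s) ^ 2 + (wl s) ^ 2 - εb * b s * w s + e0 s) s)
    (hdw : ∀ s ∈ Ioo 0 T, HasDerivAt w (w s * γ s + εb * (b s) ^ 2 + e1 s) s)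
    (hγb : ∀ s ∈ Icc 0 T, b s - 2 ≤ γ s ∧ γ s ≤ b s)
    (he0m : ∀ s ∈ Icc 0 T, |e0 s| ≤ η * m0 s) (he1m : ∀ s ∈ Icc 0 T, |e1 s| ≤ η * m1 s)
    (hm0D : ∀ s ∈ Icc 0 T, 0 ≤ m0 s ∧ m0 s ≤ m0 0 * Real.exp (-(θ * s)) +
      ∫ r in (0 : ℝ)..s, Real.exp (-(θ * (s - r))) * |-(w r) ^ 2 + (wl r) ^ 2 - εb * b r * w r|)
    (hm1D : ∀ s ∈ Icc 0 T, 0 ≤ m1 s ∧ m1 s ≤ m1 0 * Real.exp (-(θ * s)) +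
      ∫ r in (0 : ℝ)..s, Real.exp (-(θ * (s - r))) * |w r * (γ r + 1) + εb * (b r) ^ 2|)
    (hwlΦ : ∀ s ∈ Icc 0 T, ∫ r in (0 : ℝ)..s, (wl r) ^ 2 ≤ Φ₁)
    (hb0 : b 0 = B) (hw0 : w 0 = W₀) (hm00 : m0 0 ≤ μ₀) (hm10 : m1 0 ≤ μ₁)
    (hpre : ∀ s ∈ Icc 0 T, (w s) ^ 2 ≤ θ₀ ^ 2 * b s) :
    ∀ u ∈ Icc 0 T, b u ≤ B * Real.exp (-u) + Φ₁ + 1 / 2 ∧ B * Real.exp (-u) - 3 / 2 ≤ b u ∧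
      m1 u ≤ μ₁ + εb + 3 * |w u| + 3 * εb * (B + 3) ^ 2 * u := by
  have hΦ₁0 : 0 ≤ Φ₁ := by
    have h := hwlΦ 0 ⟨le_rfl, hT0⟩
    rwa [intervalIntegral.integral_same] at h
  have hθ₀1 : θ₀ ^ 2 ≤ 1 := by nlinarith
  -- continuity of the bounding functions
  have hG1 : ContinuousOn (fun u => B * Real.exp (-u) + Φ₁ + 1 / 2) (Icc 0 T) :=
    ((continuousOn_const.mul continuousOn_id.neg.rexp).add continuousOn_const).add
      continuousOn_const
  have hG2 : ContinuousOn (fun u => B * Real.exp (-u) - 3 / 2) (Icc 0 T) :=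
    (continuousOn_const.mul continuousOn_id.neg.rexp).sub continuousOn_const
  have hG3 : ContinuousOn (fun u => μ₁ + εb + 3 * |w u| + 3 * εb * (B + 3) ^ 2 * u) (Icc 0 T) :=
    (continuousOn_const.add (continuousOn_const.mul hw.norm)).add
      (continuousOn_const.mul continuousOn_id)
  -- strict bounds at the right end of a good initial segment
  have hstrict : ∀ σ ∈ Icc 0 T, (∀ u ∈ Icc 0 σ, b u ≤ B * Real.exp (-u) + Φ₁ + 1 / 2 ∧
      B * Real.exp (-u) - 3 / 2 ≤ b u ∧ m1 u ≤ μ₁ + εb + 3 * |w u| + 3 * εb * (B + 3) ^ 2 * u) →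
      b σ < B * Real.exp (-σ) + Φ₁ + 1 / 2 ∧ B * Real.exp (-σ) - 3 / 2 < b σ ∧
      m1 σ < μ₁ + εb + 3 * |w σ| + 3 * εb * (B + 3) ^ 2 * σ := by
    intro σ hσ hP
    obtain ⟨ha, -, hnn, -, -, hJ, -, hbw⟩ := incubation_apriori hεb hη hη' hημ₁ hηT hΦ₁' hT3
      hW₀ hBT hb hw hγ hdw hγb he1m hw0 hpre hσ hP
    obtain ⟨hM1, -, hK, -⟩ := incubation_majorants hεb hθ₀ hθ₀' hθ hη hη' hημ₀ hΦ₁' hb hw hγ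
      hwl hm0 he0 hdb hγb he0m hm0D hm1D hwlΦ hb0 hm00 hm10 hσ ha hnn hJ hbw
    have hσσ : σ ∈ Icc 0 σ := right_mem_Icc.2 hσ.1
    obtain ⟨hK1, hK2⟩ := hK σ hσσ
    have h1 := hM1 σ hσσ
    have hwσ := hnn σ hσσ
    have hσ3 : σ ≤ 3 := hσ.2.trans hT3
    have hσ0 : 0 ≤ σ := hσ.1
    have h2 : 0 ≤ εb * (B + 3) ^ 2 * σ := by positivity
    rw [abs_of_nonneg hwσ]
    refine ⟨by linarith, by nlinarith, by linarith⟩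
  refine incubation_induction hT0 ?_ ?_ ?_
    (P := fun u => b u ≤ B * Real.exp (-u) + Φ₁ + 1 / 2 ∧ B * Real.exp (-u) - 3 / 2 ≤ b u ∧
      m1 u ≤ μ₁ + εb + 3 * |w u| + 3 * εb * (B + 3) ^ 2 * u)
  · simp only [neg_zero, Real.exp_zero, mul_one, mul_zero, add_zero, hb0]
    exact ⟨by linarith, by linarith, by linarith [abs_nonneg (w 0)]⟩
  · intro T' hT' hP
    exact ⟨incubation_le_of_Ico hb hG1 hT' fun u hu => (hP u hu).1,
      incubation_le_of_Ico hG2 hb hT' fun u hu => (hP u hu).2.1,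
      incubation_le_of_Ico hm1 hG3 hT' fun u hu => (hP u hu).2.2⟩
  · intro T' hT' hP
    obtain ⟨h1, h2, h3⟩ := hstrict T' ⟨hT'.1, hT'.2.le⟩ hP
    obtain ⟨δ₁, hδ₁, -, hP1⟩ := incubation_lt_near hb hG1 hT' h1
    obtain ⟨δ₂, hδ₂, -, hP2⟩ := incubation_lt_near hG2 hb hT' h2
    obtain ⟨δ₃, hδ₃, -, hP3⟩ := incubation_lt_near hm1 hG3 hT' h3
    refine ⟨min δ₁ (min δ₂ δ₃), lt_min hδ₁ (lt_min hδ₂ hδ₃), fun u hu _ => ?_⟩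
    have hm1' := min_le_left δ₁ (min δ₂ δ₃)
    have hm2' := (min_le_right δ₁ (min δ₂ δ₃)).trans (min_le_left δ₂ δ₃)
    have hm3' := (min_le_right δ₁ (min δ₂ δ₃)).trans (min_le_right δ₂ δ₃)
    exact ⟨(hP1 u ⟨hu.1.le, by linarith [hu.2]⟩).le, (hP2 u ⟨hu.1.le, by linarith [hu.2]⟩).le,
      (hP3 u ⟨hu.1.le, by linarith [hu.2]⟩).le⟩


/-- **All pre-ignition bounds on the horizon.** On a pre-ignition horizon `[0, T]` as in
`incubation_boot`: carrier window `[37/2, B + 5/2]`, positivity of the bond after time `0`, the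
two-sided rate bounds, `∫₀ᵘ w² ≤ (19/25) θ₀²`, the slaved bond majorant, the carrier deviation
`-(19/25) θ₀² - (13/100) u ≤ b - B e^{-u} ≤ Φ₁ + (13/100) u` and the carrier integral
`∫₀ᵘ b = B - b(u) + O(1)`. [folklore] -/
theorem incubation_core {b w γ wl m0 m1 e0 e1 : ℝ → ℝ} {B W₀ εb θ₀ θ η μ₀ μ₁ Φ₁ T : ℝ}
    (hεb : 0 < εb) (hθ₀ : 0 < θ₀) (hθ₀' : θ₀ ≤ 1) (hθ : 1 / 2 ≤ θ) (hη : 0 ≤ η)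
    (hη' : η ≤ 1 / 100) (hημ₀ : η * μ₀ ≤ 1 / 10) (hημ₁ : η * μ₁ ≤ εb)
    (hηT : η * Real.exp (2 * T) ≤ 1 / 1000) (hΦ₁' : Φ₁ ≤ 2) (hT0 : 0 ≤ T) (hT3 : T ≤ 3)
    (hW₀ : 0 ≤ W₀) (hBT : 20 ≤ B * Real.exp (-T))
    (hb : ContinuousOn b (Icc 0 T)) (hw : ContinuousOn w (Icc 0 T))
    (hγ : ContinuousOn γ (Icc 0 T)) (hwl : ContinuousOn wl (Icc 0 T))
    (hm0 : ContinuousOn m0 (Icc 0 T)) (hm1 : ContinuousOn m1 (Icc 0 T))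
    (he0 : ContinuousOn e0 (Icc 0 T))
    (hdb : ∀ s ∈ Ioo 0 T,
      HasDerivAt b (-(b s) - (w s) ^ 2 + (wl s) ^ 2 - εb * b s * w s + e0 s) s)
    (hdw : ∀ s ∈ Ioo 0 T, HasDerivAt w (w s * γ s + εb * (b s) ^ 2 + e1 s) s)
    (hγb : ∀ s ∈ Icc 0 T, b s - 2 ≤ γ s ∧ γ s ≤ b s)
    (he0m : ∀ s ∈ Icc 0 T, |e0 s| ≤ η * m0 s) (he1m : ∀ s ∈ Icc 0 T, |e1 s| ≤ η * m1 s)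
    (hm0D : ∀ s ∈ Icc 0 T, 0 ≤ m0 s ∧ m0 s ≤ m0 0 * Real.exp (-(θ * s)) +
      ∫ r in (0 : ℝ)..s, Real.exp (-(θ * (s - r))) * |-(w r) ^ 2 + (wl r) ^ 2 - εb * b r * w r|)
    (hm1D : ∀ s ∈ Icc 0 T, 0 ≤ m1 s ∧ m1 s ≤ m1 0 * Real.exp (-(θ * s)) +
      ∫ r in (0 : ℝ)..s, Real.exp (-(θ * (s - r))) * |w r * (γ r + 1) + εb * (b r) ^ 2|)
    (hwlΦ : ∀ s ∈ Icc 0 T, ∫ r in (0 : ℝ)..s, (wl r) ^ 2 ≤ Φ₁)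
    (hb0 : b 0 = B) (hw0 : w 0 = W₀) (hm00 : m0 0 ≤ μ₀) (hm10 : m1 0 ≤ μ₁)
    (hpre : ∀ s ∈ Icc 0 T, (w s) ^ 2 ≤ θ₀ ^ 2 * b s) :
    (∀ u ∈ Icc 0 T, 37 / 2 ≤ b u ∧ b u ≤ B + 5 / 2) ∧
    (∀ u ∈ Icc 0 T, 0 ≤ w u) ∧ (∀ u ∈ Ioc 0 T, 0 < w u) ∧
    (∀ u ∈ Ioo 0 T, (b u - 203 / 100) * w u + 49 / 50 * εb * (b u) ^ 2 ≤
        w u * γ u + εb * (b u) ^ 2 + e1 u ∧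
      w u * γ u + εb * (b u) ^ 2 + e1 u ≤ (b u + 3 * η) * w u + 51 / 50 * εb * (b u) ^ 2) ∧
    (∀ u ∈ Icc 0 T, ∫ s in (0 : ℝ)..u, (w s) ^ 2 ≤ 19 / 25 * θ₀ ^ 2) ∧
    (∀ u ∈ Icc 0 T, m1 u ≤ μ₁ + 5 / 4 * w u + εb * (B + 3) ^ 2 * u) ∧
    (∀ u ∈ Icc 0 T, B * Real.exp (-u) - (19 / 25 * θ₀ ^ 2 + 13 / 100 * u) ≤ b u ∧
      b u ≤ B * Real.exp (-u) + Φ₁ + 13 / 100 * u) ∧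
    (∀ u ∈ Icc 0 T, B - b u - 19 / 25 * θ₀ ^ 2 - 13 / 100 * u ≤ ∫ s in (0 : ℝ)..u, b s ∧
      ∫ s in (0 : ℝ)..u, b s ≤ B - b u + Φ₁ + 13 / 100 * u) := by
  have hP := incubation_boot hεb hθ₀ hθ₀' hθ hη hη' hημ₀ hημ₁ hηT hΦ₁' hT0 hT3 hW₀ hBT hb hw hγ
    hwl hm0 hm1 he0 hdb hdw hγb he0m he1m hm0D hm1D hwlΦ hb0 hw0 hm00 hm10 hpre
  have hTT : T ∈ Icc 0 T := right_mem_Icc.2 hT0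
  obtain ⟨ha, -, hnn, hpos, hrate, hJ, hI2, hbw⟩ := incubation_apriori hεb hη hη' hημ₁ hηT hΦ₁'
    hT3 hW₀ hBT hb hw hγ hdw hγb he1m hw0 hpre hTT hP
  obtain ⟨hM1, -, hK, hL⟩ := incubation_majorants hεb hθ₀ hθ₀' hθ hη hη' hημ₀ hΦ₁' hb hw hγ
    hwl hm0 he0 hdb hγb he0m hm0D hm1D hwlΦ hb0 hm00 hm10 hTT ha hnn hJ hbw
  exact ⟨ha, hnn, hpos, hrate, hI2, hM1, hK, hL⟩

/-- **Upper amplification bound.** If `w' ≤ (b + 3η) w + (51/50) ε̄ b²` inside `[0, T]` with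
`0 ≤ b ≤ B + 5/2` and `B ≥ 20`, then `w(σ) ≤ e^{∫₀^σ b + 3ησ} (W₀ + 2 ε̄ B)`: the comparison
`linearComparison_upper`, where the seed integral `∫₀^σ e^{-∫₀ˢ(b+3η)} (51/50) ε̄ b² ds` is at
most `(51/50) ε̄ (B + 5/2)` because `b e^{-∫(b+3η)} ≤ -(e^{-∫(b+3η)})'`. [folklore] -/
theorem incubation_growth_upper {b w : ℝ → ℝ} {D : ℝ → ℝ} {B W₀ εb η T σ : ℝ}
    (hεb : 0 < εb) (hη : 0 ≤ η) (hB20 : 20 ≤ B)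
    (hb : ContinuousOn b (Icc 0 T)) (hw : ContinuousOn w (Icc 0 T))
    (hdw : ∀ s ∈ Ioo 0 T, HasDerivAt w (D s) s)
    (hup : ∀ s ∈ Ioo 0 T, D s ≤ (b s + 3 * η) * w s + 51 / 50 * εb * (b s) ^ 2)
    (ha : ∀ s ∈ Icc 0 T, 37 / 2 ≤ b s ∧ b s ≤ B + 5 / 2) (hw0 : w 0 = W₀) (hσ : σ ∈ Icc 0 T) :
    w σ ≤ Real.exp ((∫ s in (0 : ℝ)..σ, b s) + 3 * η * σ) * (W₀ + 2 * εb * B) := by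
  have hσT : Icc 0 σ ⊆ Icc 0 T := Icc_subset_Icc_right hσ.2
  have hKc : ContinuousOn (fun s => b s + 3 * η) (Icc 0 σ) := (hb.mono hσT).add continuousOn_const
  have hfc : ContinuousOn (fun s => 51 / 50 * εb * (b s) ^ 2) (Icc 0 σ) :=
    continuousOn_const.mul ((hb.mono hσT).pow 2)
  have hd : ∀ t ∈ Ioo 0 σ, ∃ w' : ℝ, HasDerivAt w w' t ∧
      w' ≤ (b t + 3 * η) * w t + 51 / 50 * εb * (b t) ^ 2 := fun t ht =>
    ⟨D t, hdw t ⟨ht.1, ht.2.trans_le hσ.2⟩, hup t ⟨ht.1, ht.2.trans_le hσ.2⟩⟩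
  have hcmp := linearComparison_upper hσ.1 hKc hfc (hw.mono hσT) hd (right_mem_Icc.2 hσ.1)
  obtain ⟨hPc, hPd⟩ := linearComparison_primitive hσ.1 hKc
  -- the seed integral
  set c : ℝ := 51 / 50 * εb * (B + 5 / 2) with hc
  have hc0 : 0 ≤ c := by rw [hc]; positivity
  have hφc : ContinuousOn (fun s => Real.exp (-(∫ r in (0 : ℝ)..s, (b r + 3 * η))) *
      (51 / 50 * εb * (b s) ^ 2)) (Icc 0 σ) := hPc.neg.rexp.mul hfc
  have hgc : ContinuousOn (fun s => -c * Real.exp (-(∫ r in (0 : ℝ)..s, (b r + 3 * η))))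
      (Icc 0 σ) := continuousOn_const.mul hPc.neg.rexp
  have hI := incubation_integral_le_sub hσ.1 hgc hφc fun s hs => ?_
  · simp only [intervalIntegral.integral_same, neg_zero, Real.exp_zero, mul_one] at hI
    have hE := Real.exp_pos (-(∫ r in (0 : ℝ)..σ, (b r + 3 * η)))
    have hI' : ∫ s in (0 : ℝ)..σ, Real.exp (-(∫ r in (0 : ℝ)..s, (b r + 3 * η))) *
        (51 / 50 * εb * (b s) ^ 2) ≤ c := by nlinarith
    have hWI : W₀ + ∫ s in (0 : ℝ)..σ, Real.exp (-(∫ r in (0 : ℝ)..s, (b r + 3 * η))) *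
        (51 / 50 * εb * (b s) ^ 2) ≤ W₀ + 2 * εb * B := by
      have : c ≤ 2 * εb * B := by rw [hc]; nlinarith
      linarith
    have hP : ∫ s in (0 : ℝ)..σ, (b s + 3 * η) = (∫ s in (0 : ℝ)..σ, b s) + 3 * η * σ := by
      rw [intervalIntegral.integral_add ((hb.mono hσT).intervalIntegrable_of_Icc hσ.1)
        (continuousOn_const.intervalIntegrable_of_Icc hσ.1), intervalIntegral.integral_const,
        smul_eq_mul]
      ring
    rw [hw0, hP] at hcmp
    exact hcmp.trans (mul_le_mul_of_nonneg_left hWI (Real.exp_pos _).le)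
  · refine ⟨-c * (Real.exp (-(∫ r in (0 : ℝ)..s, (b r + 3 * η))) * -(b s + 3 * η)),
      ((hPd s hs).neg.exp).const_mul (-c), ?_⟩
    have hsT : s ∈ Icc 0 T := hσT (Ioo_subset_Icc_self hs)
    obtain ⟨hbl, hbu⟩ := ha s hsT
    have hE := Real.exp_pos (-(∫ r in (0 : ℝ)..s, (b r + 3 * η)))
    have h1 : 51 / 50 * εb * (b s) ^ 2 ≤ c * (b s + 3 * η) := by
      rw [hc]
      have h2 : (b s) ^ 2 ≤ (B + 5 / 2) * (b s + 3 * η) := by nlinarith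
      nlinarith
    have h3 := mul_le_mul_of_nonneg_left h1 hE.le
    show Real.exp (-(∫ r in (0 : ℝ)..s, (b r + 3 * η))) * (51 / 50 * εb * (b s) ^ 2) ≤
      -c * (Real.exp (-(∫ r in (0 : ℝ)..s, (b r + 3 * η))) * -(b s + 3 * η))
    linarith

/-- **Lower amplification bound.** If `w' ≥ (b - 2.03) w + (49/50) ε̄ b²` inside `[0, T]`,
`w(0) ≥ 0`, `B e^{-s} - 3/2 ≤ b ≤ B + 5/2`, `B ≥ 20` and `σ ≥ 1/(2B)`, then
`(19/100) ε̄ B e^{∫₀^σ b - 2.03 σ} ≤ w(σ)`: the comparison `linearComparison_lower`, where the seed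
collected during `[0, 1/(2B)]` is at least `(19/100) ε̄ B` (there `b ≥ B - 2` and
`e^{-∫(b - 2.03)} ≥ 1 - (B + 1/2)/(2B) ≥ 39/80`). [folklore] -/
theorem incubation_growth_lower {b w : ℝ → ℝ} {D : ℝ → ℝ} {B W₀ εb T σ : ℝ}
    (hεb : 0 < εb) (hB20 : 20 ≤ B) (hW₀ : 0 ≤ W₀)
    (hb : ContinuousOn b (Icc 0 T)) (hw : ContinuousOn w (Icc 0 T))
    (hdw : ∀ s ∈ Ioo 0 T, HasDerivAt w (D s) s)
    (hlo : ∀ s ∈ Ioo 0 T, (b s - 203 / 100) * w s + 49 / 50 * εb * (b s) ^ 2 ≤ D s)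
    (ha : ∀ s ∈ Icc 0 T, 37 / 2 ≤ b s ∧ b s ≤ B + 5 / 2)
    (hKlo : ∀ s ∈ Icc 0 T, B * Real.exp (-s) - 3 / 2 ≤ b s) (hw0 : w 0 = W₀)
    (hσ : σ ∈ Icc 0 T) (hσB : 1 / (2 * B) ≤ σ) :
    19 / 100 * εb * B * Real.exp ((∫ s in (0 : ℝ)..σ, b s) - 203 / 100 * σ) ≤ w σ := by
  have hσT : Icc 0 σ ⊆ Icc 0 T := Icc_subset_Icc_right hσ.2
  have hB0 : 0 < B := by linarith
  have hKc : ContinuousOn (fun s => b s - 203 / 100) (Icc 0 σ) :=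
    (hb.mono hσT).sub continuousOn_const
  have hfc : ContinuousOn (fun s => 49 / 50 * εb * (b s) ^ 2) (Icc 0 σ) :=
    continuousOn_const.mul ((hb.mono hσT).pow 2)
  have hd : ∀ t ∈ Ioo 0 σ, ∃ w' : ℝ, HasDerivAt w w' t ∧
      (b t - 203 / 100) * w t + 49 / 50 * εb * (b t) ^ 2 ≤ w' := fun t ht =>
    ⟨D t, hdw t ⟨ht.1, ht.2.trans_le hσ.2⟩, hlo t ⟨ht.1, ht.2.trans_le hσ.2⟩⟩
  have hcmp := linearComparison_lower hσ.1 hKc hfc (hw.mono hσT) hd (right_mem_Icc.2 hσ.1)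
  obtain ⟨hPc, -⟩ := linearComparison_primitive hσ.1 hKc
  have hφc : ContinuousOn (fun s => Real.exp (-(∫ r in (0 : ℝ)..s, (b r - 203 / 100))) *
      (49 / 50 * εb * (b s) ^ 2)) (Icc 0 σ) := hPc.neg.rexp.mul hfc
  -- the seed collected during `[0, 1/(2B)]`
  set a : ℝ := 1 / (2 * B) with ha_def
  have ha0 : 0 < a := by rw [ha_def]; positivity
  have haB : a * B = 1 / 2 := by rw [ha_def]; field_simp
  have haσ : Icc 0 a ⊆ Icc 0 σ := Icc_subset_Icc_right hσB
  have hlow : ∀ s ∈ Icc 0 a, 39 / 80 * (49 / 50 * εb * (81 / 100 * B ^ 2)) ≤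
      Real.exp (-(∫ r in (0 : ℝ)..s, (b r - 203 / 100))) * (49 / 50 * εb * (b s) ^ 2) := by
    intro s hs
    have hsσ : s ∈ Icc 0 σ := haσ hs
    -- the exponent is at most `41/80`
    have hQ : ∫ r in (0 : ℝ)..s, (b r - 203 / 100) ≤ (B + 47 / 100) * (s - 0) :=
      incubation_integral_le_const hs.1 (f := fun r => b r - 203 / 100) (C := B + 47 / 100)
        (hKc.mono (Icc_subset_Icc_right hsσ.2)) fun r hr => by
          have := (ha r (hσT ⟨hr.1, hr.2.trans hsσ.2⟩)).2
          show b r - 203 / 100 ≤ B + 47 / 100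
          linarith
    have hQ' : ∫ r in (0 : ℝ)..s, (b r - 203 / 100) ≤ 41 / 80 := by
      have h1 : (B + 47 / 100) * s ≤ (B + 47 / 100) * a :=
        mul_le_mul_of_nonneg_left hs.2 (by linarith)
      nlinarith
    have hexp : 39 / 80 ≤ Real.exp (-(∫ r in (0 : ℝ)..s, (b r - 203 / 100))) := by
      have := Real.add_one_le_exp (-(∫ r in (0 : ℝ)..s, (b r - 203 / 100)))
      linarith
    -- the carrier is at least `9B/10`
    have hes : 1 - s ≤ Real.exp (-s) := by linarith [Real.add_one_le_exp (-s)]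
    have hbs : 9 / 10 * B ≤ b s := by
      have h1 := hKlo s (hσT hsσ)
      have h2 : B * (1 - s) ≤ B * Real.exp (-s) := mul_le_mul_of_nonneg_left hes hB0.le
      have h3 : B * s ≤ B * a := mul_le_mul_of_nonneg_left hs.2 hB0.le
      nlinarith
    have hb2 : 81 / 100 * B ^ 2 ≤ (b s) ^ 2 := by nlinarith
    have h4 : 49 / 50 * εb * (81 / 100 * B ^ 2) ≤ 49 / 50 * εb * (b s) ^ 2 :=
      mul_le_mul_of_nonneg_left hb2 (by positivity)
    exact mul_le_mul hexp h4 (by positivity) (Real.exp_pos _).le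
  have hIa : 39 / 80 * (49 / 50 * εb * (81 / 100 * B ^ 2)) * (a - 0) ≤
      ∫ s in (0 : ℝ)..a, Real.exp (-(∫ r in (0 : ℝ)..s, (b r - 203 / 100))) *
        (49 / 50 * εb * (b s) ^ 2) := by
    have h := incubation_integral_mono ha0.le continuousOn_const (hφc.mono haσ) hlow
    rwa [intervalIntegral.integral_const, smul_eq_mul, mul_comm] at h
  have hIrest : 0 ≤ ∫ s in a..σ, Real.exp (-(∫ r in (0 : ℝ)..s, (b r - 203 / 100))) *
      (49 / 50 * εb * (b s) ^ 2) :=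
    intervalIntegral.integral_nonneg hσB fun s _ => by positivity
  have hsplit := intervalIntegral.integral_add_adjacent_intervals
    ((hφc.mono haσ).intervalIntegrable_of_Icc (μ := volume) ha0.le)
    ((hφc.mono (Icc_subset_Icc_left ha0.le)).intervalIntegrable_of_Icc (μ := volume) hσB)
  have hI : 19 / 100 * εb * B ≤ ∫ s in (0 : ℝ)..σ,
      Real.exp (-(∫ r in (0 : ℝ)..s, (b r - 203 / 100))) * (49 / 50 * εb * (b s) ^ 2) := by
    rw [← hsplit]
    have h1 : 19 / 100 * εb * B ≤ 39 / 80 * (49 / 50 * εb * (81 / 100 * B ^ 2)) * (a - 0) := by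
      have : 39 / 80 * (49 / 50 * εb * (81 / 100 * B ^ 2)) * (a - 0) =
          39 / 80 * (49 / 50) * (81 / 100) * εb * B * (a * B) := by ring
      rw [this, haB]
      nlinarith
    linarith
  have hP : ∫ s in (0 : ℝ)..σ, (b s - 203 / 100) = (∫ s in (0 : ℝ)..σ, b s) - 203 / 100 * σ := by
    rw [intervalIntegral.integral_sub ((hb.mono hσT).intervalIntegrable_of_Icc hσ.1)
      (continuousOn_const.intervalIntegrable_of_Icc hσ.1), intervalIntegral.integral_const,
      smul_eq_mul]
    ring
  rw [hw0, hP] at hcmp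
  have hE := Real.exp_pos ((∫ s in (0 : ℝ)..σ, b s) - 203 / 100 * σ)
  have h2 : 19 / 100 * εb * B ≤ W₀ + ∫ s in (0 : ℝ)..σ,
      Real.exp (-(∫ r in (0 : ℝ)..s, (b r - 203 / 100))) * (49 / 50 * εb * (b s) ^ 2) := by
    linarith
  have h3 := mul_le_mul_of_nonneg_left h2 hE.le
  linarith

/-- **Registered stub `stub_incubationTrunc`** (truncated companion of `stub_incubation`, line
`Sketch` of crux `PerpetualPump.AveragedTypeIBlowup`): the pre-ignition bounds of phase I on an
arbitrary horizon `[0, T]` on which the front-pair data is given (`T ≤ 3`, `20 ≤ B e^{-T}`,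
`η e^{2T} ≤ 10⁻³`) and no ignition has happened (`w² ≤ θ₀² b`): the carrier stays in
`[B e^{-σ} - 3/2, B e^{-σ} + Φ₁ + 1/2]`, the bond is positive after time `0`,
`∫₀ᵀ w² ≤ 2 θ₀²`, and the bond majorant is slaved, `m₁ ≤ μ₁ + 2 w + 2 ε̄ (B+3)² σ`. Several
hypotheses of the full stub are kept for interface uniformity although unused here. [folklore] -/
theorem stub_incubationTrunc :
    ∀ (b w γ wl m0 m1 e0 e1 : ℝ → ℝ) (B W₀ εb θ₀ θ η μ₀ μ₁ Φ₁ T : ℝ),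
      0 < εb → εb ≤ 1 / 10 ^ 6 → 0 < θ₀ → θ₀ ≤ 1 → 1 / 2 ≤ θ → θ ≤ 1 → 0 ≤ η → η ≤ 1 / 100 →
      0 ≤ μ₀ → η * μ₀ ≤ 1 / 10 → 0 ≤ μ₁ → η * μ₁ ≤ εb → η * Real.exp (2 * T) ≤ 1 / 1000 →
      0 ≤ Φ₁ → Φ₁ ≤ 2 → 0 < T → T ≤ 3 → 0 ≤ W₀ → W₀ ^ 2 < θ₀ ^ 2 * B → 20 ≤ B * Real.exp (-T) →
      ContinuousOn b (Icc 0 T) → ContinuousOn w (Icc 0 T) → ContinuousOn γ (Icc 0 T) →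
      ContinuousOn wl (Icc 0 T) → ContinuousOn m0 (Icc 0 T) → ContinuousOn m1 (Icc 0 T) →
      ContinuousOn e0 (Icc 0 T) → ContinuousOn e1 (Icc 0 T) →
      (∀ σ ∈ Ioo 0 T, HasDerivAt b (-(b σ) - (w σ) ^ 2 + (wl σ) ^ 2 - εb * b σ * w σ + e0 σ) σ) →
      (∀ σ ∈ Ioo 0 T, HasDerivAt w (w σ * γ σ + εb * (b σ) ^ 2 + e1 σ) σ) →
      (∀ σ ∈ Icc 0 T, b σ - 2 ≤ γ σ ∧ γ σ ≤ b σ) →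
      (∀ σ ∈ Icc 0 T, |e0 σ| ≤ η * m0 σ) → (∀ σ ∈ Icc 0 T, |e1 σ| ≤ η * m1 σ) →
      (∀ σ ∈ Icc 0 T, 0 ≤ m0 σ ∧ m0 σ ≤ m0 0 * Real.exp (-(θ * σ)) +
        ∫ u in (0 : ℝ)..σ, Real.exp (-(θ * (σ - u))) * |-(w u) ^ 2 + (wl u) ^ 2 - εb * b u * w u|) →
      (∀ σ ∈ Icc 0 T, 0 ≤ m1 σ ∧ m1 σ ≤ m1 0 * Real.exp (-(θ * σ)) +
        ∫ u in (0 : ℝ)..σ, Real.exp (-(θ * (σ - u))) * |w u * (γ u + 1) + εb * (b u) ^ 2|) →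
      (∀ σ ∈ Icc 0 T, ∫ u in (0 : ℝ)..σ, (wl u) ^ 2 ≤ Φ₁) →
      b 0 = B → w 0 = W₀ → m0 0 ≤ μ₀ → m1 0 ≤ μ₁ →
      (∀ σ ∈ Icc 0 T, (w σ) ^ 2 ≤ θ₀ ^ 2 * b σ) →
      (∀ σ ∈ Icc 0 T, B * Real.exp (-σ) - 3 / 2 ≤ b σ ∧ b σ ≤ B * Real.exp (-σ) + Φ₁ + 1 / 2) ∧
      (∀ σ ∈ Ioc 0 T, 0 < w σ) ∧
      (∫ u in (0 : ℝ)..T, (w u) ^ 2 ≤ 2 * θ₀ ^ 2) ∧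
      (∀ σ ∈ Icc 0 T, m1 σ ≤ μ₁ + 2 * w σ + 2 * εb * (B + 3) ^ 2 * σ) := by
  intro b w γ wl m0 m1 e0 e1 B W₀ εb θ₀ θ η μ₀ μ₁ Φ₁ T hεb _ hθ₀ hθ₀' hθ _ hη hη' _ hημ₀ _ hημ₁ hηT
    _ hΦ₁' hT hT3 hW₀ _ hBT hb hw hγ hwl hm0 hm1 he0 _ hdb hdw hγb he0m he1m hm0D hm1D hwlΦ hb0 hw0
    hm00 hm10 hpre
  obtain ⟨-, hnn, hpos, -, hI2, hM1, hK, -⟩ := incubation_core hεb hθ₀ hθ₀' hθ hη hη' hημ₀ hημ₁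
    hηT hΦ₁' hT.le hT3 hW₀ hBT hb hw hγ hwl hm0 hm1 he0 hdb hdw hγb he0m he1m hm0D hm1D hwlΦ hb0
    hw0 hm00 hm10 hpre
  have hθ₀1 : θ₀ ^ 2 ≤ 1 := by nlinarith
  refine ⟨fun σ hσ => ?_, hpos, ?_, fun σ hσ => ?_⟩
  · obtain ⟨h1, h2⟩ := hK σ hσ
    have hσ3 : σ ≤ 3 := hσ.2.trans hT3
    constructor <;> nlinarith [hσ.1]
  · have h := hI2 T (right_mem_Icc.2 hT.le)
    nlinarith [sq_nonneg θ₀]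
  · have h1 := hM1 σ hσ
    have h2 := hnn σ hσ
    have h3 : 0 ≤ εb * (B + 3) ^ 2 * σ := by
      have := hσ.1
      positivity
    linarith

end Summit.NavierStokesRegularity.NavierStokesRegularity.Theorems.PerpetualPumpAveragedTypeIBlowup

end
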